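import Literature.Claims.NS.Chae2007
import Literature.Claims.NS.ClayR3SupBlowupCertificate
import Literature.Analysis.FluidPDE.LerayHopf
import Literature.Barriers.NavierStokesRegularity.SupNormCalderonZygmundWitnesses
import Literature.Analysis.FluidPDE.BKMClassVorticitySupLipschitz
import Literature.Analysis.FluidPDE.NSVorticityBKMMaximal
import Literature.Analysis.FluidPDE.NSFiniteEnergySmoothProofs
import HarnessLib

/-!
# CLAIM C164 — N. Piromthan, «Finite-Time Blowup in the 3D Incompressible Navier–Stokes Equations
# from Smooth Initial Data» (Zenodo 15737494, 2025, 8 pp.)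

Cell `ns-claims` (D-0090), claim **C164** (RULINGS v1.41, lead-1 g6, 2026-08-27T14:00:58Z; tail tranche
4e, census A26), typist of record `ns-claims-typist-2 g7`. TEXT OF RECORD: Zenodo record 15737494
(concept 15737493, single version, 2025-06-25), PDF sha256[:16] `3e39b6d25c4518e3`, 8 pp., PDF page =
printed page = `pages/pNNN.txt` of `run/shared/lean/pub/ns-claims/sources/Piromthan2025/` (LOCATORS v2,
ns-claims-lit-2; census pin `census/texts/Piromthan2025/`); bib `Piromthan2025`. UNREFEREED CLAIM under
adjudication — NOTHING in this file asserts a step of the paper: the claimed statement, the printed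
displays and the printed inferences are `def … : Prop`; the only `theorem`s are pure-logic compositions
of the paper's own chain and the Clay (C) identification through the tree's sup-norm blow-up certificate.
The text has NO theorem / lemma environments (displays (1)–(8) only) and prints «(??)» at p.3 l.42.

## The claimed statement, as printed (p.7 l.55–65, the only formal-register sentence)
«In formal terms, we have shown: There exist smooth, compactly supported, divergence-free initial
velocity fields u0 ∈ C∞c(R³) such that the corresponding solution u(x, t) to the incompressible
Navier–Stokes equations with positive viscosity becomes singular in finite time T∗, and no extension of
the solution is possible either as a classical solution or as a weak Leray–Hopf solution satisfying the
energy inequality.» («becomes singular» = «finite-time blowup of ∥ω(t)∥L∞», p.4 l.8–9, p.5 l.34,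
p.6 l.38; the Leray–Hopf clause = §5.2 p.6 l.34–94.) Typed as `ClaimedTheorem` (NEG, ℝ³, every `ν > 0`).

## Clay delta (reference `Literature/Claims/NS/ClayVariants.lean`; nearest = (C) `clayR3.Breakdown`)
Δ1 domain ℝ³ (=) · Δ2 equations (1) (=) · Δ3 force ≡ 0 (inside class (5)) · Δ4 data `C∞_c` ⊂ class (4)
(NARROWER; admissible for the ∃-statement (C)) · Δ5 solution notion: «the corresponding solution» = the
local smooth solution, typed as a finite-energy classical solution on `ℝ³ × [0,T*)` with all `L²`
Sobolev norms bounded on closed sub-slabs (`IsSol`; §5.1 works in `H^s`, §5.2 uses the energy (8)) ·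
Δ6 conclusion «‖ω(t)‖_∞ blows up at T* < ∞» ⇒ (C) by the tree's vorticity sup-norm certificate
(`ClayVariants.navierStokesBreakdownR3_of_vorticitySupCertificate`: Tao's uniqueness + `L^∞_t H^k_x`
bounds of the Clay solution) — **`clay_of_claimed : ClaimedTheorem → clayR3.Breakdown` PROVED**, no Δ ·
Δ7 «positive viscosity» (every `ν > 0`; one suffices for (C)) · Δ8 EXTRA CLAUSES beyond (C): «no extension
… as a weak Leray–Hopf solution satisfying the energy inequality» (§5.2) and «no classical extension»
(§5.1) — typed inside `ClaimedTheorem` as printed (`NoLerayHopfExtension`, `NoClassicalExtension`);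
(C) says nothing about weak solutions; the tree's PROVED `leray_existence_R3_holds` is the relevant
neighbour of the weak clause (recorded; conclusion-level, LETTERING RULE 12:45Z (1)).

## The printed chain (LOCATORS §1) and the typed Steps, in DEPENDENCY ORDER (TYPING-HYGIENE 11)
* Step 1 = `Step4_CZ` — (4) p.3 l.1–5 «∥∇u∥L∞ ≤ C∥ω∥L∞, for some universal constant C > 0 … derived
  from the Calderón–Zygmund kernel bound» — FIELD level (every `H^∞` divergence-free field: the class
  containing the `C∞_c` data AND every slice `u(·,t)`, `t < T`, of a class solution), junk-free `∀ M` form.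
* Step 2 = `Step5_maxPrinciple` — p.3 l.9–12 «Applying the maximum principle to (2) … d/dt W(t) ≤
  ∥∇u(t)∥L∞ · W(t) + ν∥∆ω(t)∥L∞» along every class solution (`W u t = ‖ω(t)‖_∞`, right derivative).
* Step 2′ = `Step_Wcont` (rev 2) — implicit in «d/dt W(t)» p.3 l.11: `W` is continuous on `[0,T)` along
  every class solution. TRUE-type; consumed by the T* comparison.
* Step 3 = `Step45_subst` — p.3 l.13–16 «Substituting the bound ∥∇u∥L∞ ≤ CW(t), we have (5)»: the
  printed inference (4) ∧ (max. principle) ⇒ (5), typed as the implication `Step4_CZ → Step5_maxPrinciple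
  → Step5`.
* Step 4 = `Step56_subst P` — p.3 l.17–36 «∥∆ω(t)∥L∞ ≤ (C′/δ(t)²)W(t) … Substituting into (5), we obtain
  (6)»: the printed inference (5) ∧ (posited Laplacian bound) ⇒ (6) (`Step5 → PositLap P → Step6 P`).
  The «thickness of the vorticity support» `δ(t)`, the geometry constant `C′`, the decay rate `α` of
  «δ(t) ∼ δ0e^{−αt}» (p.3 l.40–41, p.5 l.16–18) and the «explicitly computable» constants `A, B` and the
  largeness/smallness thresholds of (7) are POSITED, never defined or derived in print: they are the data of
  `P : Posits`, their printed laws are the named posits `PositLap P` / `PositDecay P` (posits are not steps,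
  RULINGS 11:21Z (1); they enter the composition as hypotheses and are REFEREE objects).
* Step 5 = `Step67_dropping P` (solution grain) / `Step67_abs P` (rev 2, real-function grain) — p.3 l.37–48 «the second term … grows
  only polynomially, while the first term grows quadratically. For initial data where W(0) is large and
  δ(0) is small, the nonlinear term dominates. Dropping the subdominant dissipation yields a Riccati-type
  inequality (7)»: the printed inference (6) ∧ (δ-decay) ⇒ (7) AT THE REAL-FUNCTION GRAIN (TYPING-HYGIENE
  13: the passage manipulates the functions `W(t)`, `δ(t)` only; `A, B` and the thresholds fixed before the
  function), with PROVED glue `step67_of_abs : Step67_abs P → Step67_dropping P` to the solution-grain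
  implication `Step6 P → PositDecay P → Step7 P` of rev 1. ((5), (6) are UPPER bounds «≤» for dW/dt; (7) is
  a LOWER bound «≥»; no display between (6) and (7).)
* Step 6 = `Step7 P` — **display (7) p.3 l.45–48** «d/dt W(t) ≥ AW(t)² − BW(t), for constants A, B > 0
  explicitly computable from C1, C2, and the rate of δ(t) decay», read with «for initial data where W(0)
  is large and δ(0) is small» (l.43): along every class solution whose datum passes the posited
  thresholds, at every `t ∈ [0,T)`.
* Step 7 = `Step_Tstar` — p.4 l.1–7 «The general solution to (7) blows up in finite time if AW(0) > B,
  with blowup time bounded above by T∗ ≤ 1/(AW(0) − B)» at the ODE grain (F15): a real function with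
  right derivative `≥ AW² − BW` on `[0,T)` and `AW(0) > B` has `T ≤ 1/(AW(0) − B)` (`w` continuous on
  `[0,T)` — rev 2). TRUE-type (Riccati comparison; `log(1+x) ≤ x`; Summits-side twin
  `…Theorems.Piromthan2025Salvage.noncontinuation`, p537577).
* Step 8 = `Step43 P` — §4 p.4 l.13–37 + §4.3 p.5 l.22–34: the explicit datum «uθ(r, z) = Γχδ(r, z)»,
  `ur = uz = 0` (a `C∞_c` axisymmetric pure-swirl field — `swirl Γ χ`), «with W(0) ≳ Γ/δ0. For
  sufficiently small δ0 and large Γ, this ensures AW(0) > B»: for every `ν > 0` some member of the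
  printed family is a datum of the class whose every class solution passes the thresholds of (7) with
  `A·W(0) > B`.
* Step 9 = `Step_BKM` — the local theory + Beale–Kato–Majda continuation the text presupposes («the
  corresponding solution», p.7 l.61; [1] cited p.6 l.57–58): from every datum of the class EITHER a global
  class solution exists OR a class solution on some `[0,T*)`, `T* > 0`, with `‖ω(t)‖_∞` unbounded on
  `[0,T*)`. Implicit, classical (TRUE-type for `C∞_c ⊂ H^∞` data: tree `beale_kato_majda_holds`,
  `MajdaBertozzi2002_localExistenceH3_holds`), typed as used.
* Step 10 = `Step51` — §5.1 p.6 l.1–33 «the classical solution cannot be continued in Hs past T∗»: no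
  class solution on a longer slab agrees with the blow-up solution on `[0,T*)`. TRUE-type (a class
  solution on `[0,T)`, `T > T*`, has bounded vorticity on the closed sub-slab `[0,T*]`).
* Step 11 = `Step52` — §5.2 p.6 l.34–94 «∫0^{T∗}∥∇u(s)∥²L2 ds = ∞. This contradicts the energy
  inequality (8) … Therefore, the Leray–Hopf weak solution cannot be extended past T∗», typed as the
  printed inference at the conclusion level: vorticity blow-up of the class solution on `[0,T*)` ⇒ no
  global Leray–Hopf weak solution from `u₀` agrees with it on `[0,T*)`. Typist's flag: the tree PROVES
  `leray_existence_R3_holds` (a global Leray–Hopf weak solution exists from every `L²` datum); with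
  weak–strong uniqueness that solution agrees with the smooth one while the latter exists — conclusion-
  level handle, never the head while an upstream consumed step fails. Records (rev 2, REF-4 (a)/(h)):
  `NoGlobalLerayHopf` (the abstract's face of the weak clause, p.1 l.10–11 — the class of the tree's
  `leray_existence_R3_holds`), `ClaimedTheoremSomeNu` (the `∃ν` face), §5.2 displays `Step52_S1 P`
  («‖∇u‖²_{L²} ≳ ‖ω‖²_∞δ³» p.6 l.63–80) and `Step52_S2` («‖ω(s)‖_∞ ≳ 1/(T∗ − s)» p.6 l.81–83, real-function
  grain) — none consumed.

COMPOSITION (PROVED, pure logic + `linarith`): `claim_of_steps (P : Posits) : Step4_CZ →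
Step5_maxPrinciple → Step_Wcont → Step45_subst → PositLap P → Step56_subst P → PositDecay P →
Step67_dropping P → Step_Tstar → Step43 P → Step_BKM → Step51 → Step52 → ClaimedTheorem` — the rev-1 binder
list in the dependency order above with the continuity face `Step_Wcont` inserted (every display of the
printed chain is CONSUMED: (4) and the maximum-principle line feed (5), (5) and the Laplacian posit feed (6),
(6) and the decay posit feed (7) through the paper's own «Substituting» / «Dropping» sentences typed as
implications — the C150 `Fathi2025` pattern); `claim_of_steps_abs` = the same with the real-function grain
`Step67_abs P` as binder 5 (via `step67_of_abs`). `clay_of_claimed : ClaimedTheorem →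
ClayVariants.clayR3.Breakdown` PROVED (vorticity sup-norm certificate at `ν = 1`). REVISIONS: rev 1 p537799 @
77699d9665da; rev 2 p538919 @ 42e63a06394c (CHAIR 14:28Z (1)) = `Step_Tstar` + `ContinuousOn` (in place,
REF-4 F-PASS (2) artefact fix), `Step_Wcont`, `Step67_abs` + glue, records faces; rev 3 (append-only
theorems, §G) DISCHARGES `Step51` (`step51_holds`), `Step45_subst` (`step45_subst_holds`) and `Step_Tstar`
(`step_Tstar_holds`, via the Riccati comparison `riccati_noncontinuation`) in the kernel — TRUE column.
VERDICT of record (refuter-3 g5 14:31:21Z): first failing step = `Step4_CZ`, class false lemma, by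
`Summit.NavierStokesRegularity.NavierStokesRegularity.Theorems.Piromthan2025.not_Step4_CZ`.

Cell files: `claims/Piromthan2025/CARD.md` (typist-2 g7; PREDICTION sealed 2026-08-27T14:02:53Z, sha16
8a12fd8c1c2f9474 = `CARD.at-prediction.md`). WHAT THIS IS NOT: not a claim about NS regularity or
blow-up; not a claim about any author beyond the typed locator.
-/

noncomputable section

open MeasureTheory Set Filter Topology
open scoped ENNReal NNReal ContDiff RealInnerProductSpace Laplacian InnerProductSpace

namespace Literature.Claims.NS.Piromthan2025

open Literature.Analysis Literature.Analysis.FluidPDE Literature.Claims.NS.ClayVariants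

/-! ## A. Vocabulary -/

/-- Euclidean `ℝ³`. [folklore] -/
abbrev E3 : Type := EuclideanSpace ℝ (Fin 3)

/-- **The printed data class** (p.1 l.26, p.1 l.33–37, p.7 l.56–60): «smooth, compactly supported,
divergence-free» `u₀ ∈ C∞_c(ℝ³)`. [cite: Piromthan2025, p.1 l.26; p.7 l.56–60] -/
def IsDatum (u₀ : E3 → E3) : Prop :=
  ContDiff ℝ ∞ u₀ ∧ NSWave0.IsDivFree u₀ ∧ HasCompactSupport u₀

/-- **«The corresponding solution u(x,t)»** (p.7 l.61) on `ℝ³ × [0,T)`: the local smooth solution of (1)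
from `u₀` — classical (jointly `C^∞` velocity/pressure, (1) pointwise) on `[0,T)`, `u(0) = u₀`, finite
energy on `[0,T)` ((8) p.6), and all `L²` Sobolev norms of `u` bounded on every closed sub-slab
`[0,T'']`, `T'' < T` (§5.1 tracks `‖u(t)‖_{H^s}`; this is the Beale–Kato–Majda class of the tree, in
which `W(t) = ‖ω(t)‖_∞` is finite for `t < T`). [cite: Piromthan2025, (1) p.1 l.18–27; §5.1 p.6 l.1–10; (8) p.6 l.41–55] -/
structure IsSol (ν : ℝ) (u₀ : E3 → E3) (T : ℝ) (u : ℝ → E3 → E3) (p : ℝ → E3 → ℝ) : Prop where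
  /-- (1) holds classically on `ℝ³ × [0,T)`. -/
  classical : IsClassicalNSSolutionOn (Ico 0 T) ν 0 u p
  /-- `u(x,0) = u₀(x)`. -/
  initial : u 0 = u₀
  /-- finite energy on `[0,T)` ((8) p.6). -/
  energy : ∃ A : ℝ≥0∞, A < ⊤ ∧ ∀ t ∈ Ico 0 T, ∫⁻ x, ‖u t x‖ₑ ^ 2 ≤ A
  /-- all `L²` Sobolev norms bounded on every closed sub-slab (§5.1's `H^s` setting). -/
  sobolev : ∀ T'' < T, HasBoundedSobolevNormsOn (Icc 0 T'') u

/-- A GLOBAL class solution (`[0,∞)`): the same on every `[0,T)`. [cite: Piromthan2025, p.1 l.28–30] -/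
def IsGlobalSol (ν : ℝ) (u₀ : E3 → E3) (u : ℝ → E3 → E3) (p : ℝ → E3 → ℝ) : Prop :=
  ∀ T : ℝ, 0 < T → IsSol ν u₀ T u p

/-- `‖ω(·,t)‖_{L∞}` of the slice `u(·,t)` as an extended real (`ω = ∇ × u`, (2) p.2 l.18–20).
[cite: Piromthan2025, §3 p.3 l.7–8] -/
def vortSup (u : ℝ → E3 → E3) (t : ℝ) : ℝ≥0∞ := ⨆ x, ‖curl (u t) x‖ₑ

/-- **`W(t) := ∥ω(t)∥L∞`** (p.3 l.7–8) as a real number (`toReal`; finite along a class solution for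
`t < T`, junk `0` where the vorticity is unbounded — the blow-up itself is typed junk-free, `VortBlowsUp`).
[cite: Piromthan2025, §3 p.3 l.7–8] -/
def W (u : ℝ → E3 → E3) (t : ℝ) : ℝ := (vortSup u t).toReal

/-- **«finite-time blowup of ∥ω(t)∥L∞»** at `T` (p.4 l.8–9, p.5 l.34): the vorticity is UNBOUNDED on
`[0,T) × ℝ³` (TYPING-HYGIENE 1: no suprema). [cite: Piromthan2025, p.4 l.8–9; p.5 l.34; p.6 l.38] -/
def VortBlowsUp (u : ℝ → E3 → E3) (T : ℝ) : Prop :=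
  ∀ M : ℝ, ∃ t ∈ Ico 0 T, ∃ x : E3, M < ‖curl (u t) x‖

/-- **«no extension of the solution is possible … as a classical solution»** (p.7 l.64–65; §5.1 p.6
l.31–33): no class solution from `u₀` on a longer slab `[0,T)`, `T > T*`, agrees with `u` on `[0,T*)`.
[cite: Piromthan2025, p.7 l.64–65; §5.1 p.6 l.31–33] -/
def NoClassicalExtension (ν : ℝ) (u₀ : E3 → E3) (Ts : ℝ) (u : ℝ → E3 → E3) : Prop :=
  ¬ ∃ (T : ℝ) (v : ℝ → E3 → E3) (q : ℝ → E3 → ℝ), Ts < T ∧ IsSol ν u₀ T v q ∧ ∀ t ∈ Ico 0 Ts, v t = u t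

/-- **«no extension of the solution is possible … as a weak Leray–Hopf solution satisfying the energy
inequality»** (p.7 l.64–65; §5.2 p.6 l.92–94 «the Leray–Hopf weak solution cannot be extended past
T∗»): no GLOBAL Leray–Hopf weak solution of the unforced system from `u₀` (tree
`FluidPDE.IsGlobalLerayHopf`: weak solution on every `[0,T)` with the energy inequality (8)) agrees with
`u` on `[0,T*)`. [cite: Piromthan2025, p.7 l.64–65; §5.2 p.6 l.34–94] -/
def NoLerayHopfExtension (ν : ℝ) (u₀ : E3 → E3) (Ts : ℝ) (u : ℝ → E3 → E3) : Prop :=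
  ¬ ∃ v : ℝ → E3 → E3, FluidPDE.IsGlobalLerayHopf ν 0 u₀ v ∧ ∀ t ∈ Ico 0 Ts, v t = u t

/-- **The abstract's face of the weak clause (rev 2; REF-4 (a))**: «no … Leray–Hopf weak solution can be
continued beyond the singularity time» (p.1 l.10–11) read as: NO global Leray–Hopf weak solution of the
unforced system issues from `u₀` at all — the class of the tree's PROVED `leray_existence_R3_holds`. Implies
the literal extension face (`noLerayHopfExtension_of_noGlobal`). Not consumed by the composition.
[claim: Piromthan2025, status: under-review] [cite: Piromthan2025, abstract p.1 l.10–11; §5.2 p.6 l.92–94] -/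
def NoGlobalLerayHopf (ν : ℝ) (u₀ : E3 → E3) : Prop :=
  ¬ ∃ v : ℝ → E3 → E3, FluidPDE.IsGlobalLerayHopf ν 0 u₀ v

/-- The abstract's face implies the literal one. [cite: Piromthan2025, p.7 l.64–65] -/
theorem noLerayHopfExtension_of_noGlobal {ν : ℝ} {u₀ : E3 → E3} (h : NoGlobalLerayHopf ν u₀) (Ts : ℝ)
    (u : ℝ → E3 → E3) : NoLerayHopfExtension ν u₀ Ts u :=
  fun ⟨v, hv, _⟩ => h ⟨v, hv⟩

/-- Cylindrical radius `r = √(x₀² + x₁²)`. [cite: Piromthan2025, §4 p.4 l.17–19] -/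
def rad (x : E3) : ℝ := Real.sqrt (x 0 ^ 2 + x 1 ^ 2)

/-- `r·ê_θ = (−x₁, x₀, 0)`. [cite: Piromthan2025, §4 p.4 l.17–21] -/
def rotv (x : E3) : E3 := WithLp.toLp 2 ![-(x 1), x 0, 0]

/-- **The printed datum family §4 p.4 l.20–27**: «u0(r, θ, z) = uθ(r, z) êθ», «uθ(r, z) = Γχδ(r, z)»,
«ur = uz = 0», with an axisymmetric profile `χ = χ(r,z)`: `u₀(x) = Γ·χ(r,z)·ê_θ = (Γ χ(r,z)/r)·(−x₁, x₀, 0)`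
(the profile is supported away from the axis, p.4 l.24: `|r − R| < δ`). [cite: Piromthan2025, §4 p.4 l.20–27] -/
def swirl (Γ : ℝ) (χ : ℝ → ℝ → ℝ) (x : E3) : E3 := (Γ * χ (rad x) (x 2) / rad x) • rotv x

/-- **The bump of §4 p.4 l.24–25**: «χδ … a smooth radial bump function with support in |r − R| < δ and
|z| < δ, for small δ > 0» (with `0 < δ < R`, so the support misses the axis), not identically zero.
[cite: Piromthan2025, §4 p.4 l.24–25] -/
def IsBump (R δ : ℝ) (χ : ℝ → ℝ → ℝ) : Prop :=
  0 < δ ∧ δ < R ∧ ContDiff ℝ ∞ (Function.uncurry χ) ∧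
    (∀ r z, χ r z ≠ 0 → |r - R| < δ ∧ |z| < δ) ∧ ∃ r z, χ r z ≠ 0

/-! ## B. The claimed statement (nothing asserted) -/

/-- **CLAIMED THEOREM = p.7 l.55–65, AS PRINTED** (every `ν > 0`, (1) p.1 l.25): there is a smooth,
compactly supported, divergence-free datum whose corresponding class solution lives on some `[0,T*)`,
`0 < T* < ∞`, with `‖ω(t)‖_∞` unbounded there («becomes singular in finite time T∗»), admits no classical
extension and no extension as a global Leray–Hopf weak solution with the energy inequality.
[claim: Piromthan2025, status: under-review] [cite: Piromthan2025, p.7 l.55–65; abstract p.1 l.5–12] -/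
def ClaimedTheorem : Prop :=
  ∀ ν : ℝ, 0 < ν → ∃ u₀ : E3 → E3, IsDatum u₀ ∧
    ∃ (Ts : ℝ) (u : ℝ → E3 → E3) (p : ℝ → E3 → ℝ), 0 < Ts ∧ IsSol ν u₀ Ts u p ∧ VortBlowsUp u Ts ∧
      NoClassicalExtension ν u₀ Ts u ∧ NoLerayHopfExtension ν u₀ Ts u

/-- **The weaker `∃ν` face of «with positive viscosity»** (p.7 l.61–62 leaves ν unquantified; REF-4 (a)):
the same for SOME `ν > 0`. Recorded; implied by `ClaimedTheorem` (`claimed_someNu_of_claimed`).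
[claim: Piromthan2025, status: under-review] [cite: Piromthan2025, p.7 l.55–65] -/
def ClaimedTheoremSomeNu : Prop :=
  ∃ ν : ℝ, 0 < ν ∧ ∃ u₀ : E3 → E3, IsDatum u₀ ∧
    ∃ (Ts : ℝ) (u : ℝ → E3 → E3) (p : ℝ → E3 → ℝ), 0 < Ts ∧ IsSol ν u₀ Ts u p ∧ VortBlowsUp u Ts ∧
      NoClassicalExtension ν u₀ Ts u ∧ NoLerayHopfExtension ν u₀ Ts u

/-- `∀ν` face ⇒ `∃ν` face. [cite: Piromthan2025, p.7 l.55–65] -/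
theorem claimed_someNu_of_claimed (h : ClaimedTheorem) : ClaimedTheoremSomeNu := ⟨1, one_pos, h 1 one_pos⟩

/-! ## C. Posited objects of §3–§4 (never defined or derived in print; REFEREE objects) -/

/-- **The posited objects**: `δ u t` = «δ(t) … the minimum radius of curvature or thickness of the
vorticity support» along the solution `u` (p.3 l.17–18, words only); `Cp` = «C′ depends on the geometry
of the vorticity profile» (p.3 l.25–26); `α u` = the rate in «δ(t) ∼ δ0e^{−αt} for some α > 0» (p.3
l.40–41; p.5 l.16–19 «δ(t) ≲ δ0e^{−αt}»); `A ν a`, `B ν a` = «constants A, B > 0 explicitly computable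
from C1, C2, and the rate of δ(t) decay» (p.3 l.48; never computed); `W₀ ν a`, `d₀ ν a` = the
thresholds of «For initial data where W(0) is large and δ(0) is small» (p.3 l.43) / «For sufficiently
small δ0 and large Γ» (p.5 l.27). [cite: Piromthan2025, p.3 l.17–48; p.5 l.13–27] -/
structure Posits where
  /-- «thickness of the vorticity support» `δ(t)` along a velocity field `u`. -/
  δ : (ℝ → E3 → E3) → ℝ → ℝ
  /-- the geometry constant `C′` of «∥∆ω(t)∥L∞ ≤ (C′/δ(t)²)W(t)». -/
  Cp : ℝ
  /-- the decay rate `α` of «δ(t) ∼ δ0e^{−αt}» along `u`. -/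
  α : (ℝ → E3 → E3) → ℝ
  /-- the Riccati constants `A, B` of (7), as functions of the viscosity and the decay rate. -/
  A : ℝ → ℝ → ℝ
  /-- see `A`. -/
  B : ℝ → ℝ → ℝ
  /-- largeness threshold for `W(0)`. -/
  W₀ : ℝ → ℝ → ℝ
  /-- smallness threshold for `δ(0)`. -/
  d₀ : ℝ → ℝ → ℝ

/-- **Posit 1 — p.3 l.17–28** «For sufficiently smooth and localized fields, we may bound ∥∆ω(t)∥L∞ ≤
(C′/δ(t)²) W(t)» along every class solution (with `δ(t) > 0`). A posit, not a step.
[claim: Piromthan2025, status: under-review] [cite: Piromthan2025, p.3 l.17–28] -/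
def PositLap (P : Posits) : Prop :=
  ∀ (ν : ℝ) (u₀ : E3 → E3) (T : ℝ) (u : ℝ → E3 → E3) (p : ℝ → E3 → ℝ), 0 < ν → IsSol ν u₀ T u p →
    ∀ t ∈ Ico 0 T, 0 < P.δ u t ∧ ∀ x, ‖Δ (curl (u t)) x‖ ≤ P.Cp / P.δ u t ^ 2 * W u t

/-- **Posit 2 — p.3 l.39–41 / p.5 l.13–19** «the vorticity core radius decreases roughly exponentially:
δ(t) ∼ δ0e^{−αt} for some α > 0» / «δ(t) ≲ δ0e^{−αt}» along every class solution. A posit, not a step.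
[claim: Piromthan2025, status: under-review] [cite: Piromthan2025, p.3 l.39–41; p.5 l.13–19] -/
def PositDecay (P : Posits) : Prop :=
  ∀ (ν : ℝ) (u₀ : E3 → E3) (T : ℝ) (u : ℝ → E3 → E3) (p : ℝ → E3 → ℝ), 0 < ν → IsSol ν u₀ T u p →
    0 < P.α u ∧ ∀ t ∈ Ico 0 T, P.δ u t ≤ P.δ u 0 * Real.exp (-(P.α u * t))

/-! ## D. The printed displays and inferences (nothing asserted) -/

/-- **Step 1 — display (4) p.3 l.1–5** «one can estimate the gradient of the velocity field in terms of
the vorticity: ∥∇u∥L∞ ≤ C∥ω∥L∞, for some universal constant C > 0. This key estimate, derived from the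
Calderón–Zygmund kernel bound, will serve as the core of our nonlinear blowup mechanism.» Typed at FIELD
level over the `H^∞` divergence-free class (tree `Chae2007.IsDatum`: `C^∞`, divergence free, every
derivative in `L²` — contains the `C∞_c` data and every slice `u(·,t)`, `t < T`, of a class solution, and
is a class on which the Biot–Savart law (3) holds), junk-free: every vorticity bound `M` bounds the
velocity gradient by `C·M`. Typist's flag: known-false pattern (the double Riesz transform is unbounded
on `L^∞`; only the Beale–Kato–Majda logarithmic form holds — the paper's own [1]).
[claim: Piromthan2025, status: under-review] [cite: Piromthan2025, (4) p.3 l.1–5; (3) p.2 l.26–47] -/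
def Step4_CZ : Prop :=
  ∃ C : ℝ, 0 < C ∧ ∀ v : E3 → E3, Chae2007.IsDatum v →
    ∀ M : ℝ, (∀ y, ‖curl v y‖ ≤ M) → ∀ x, ‖fderiv ℝ v x‖ ≤ C * M

/-- **Step 2 — the maximum-principle line p.3 l.9–12** «Applying the maximum principle to (2) (see e.g.,
[1]), and estimating each term using (4), we obtain: d/dt W(t) ≤ ∥∇u(t)∥L∞ · W(t) + ν∥∆ω(t)∥L∞» along
every class solution: at every `t ∈ [0,T)` the right derivative `D` of `W` exists and `D ≤ G·W(t) + ν·L`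
for every bound `G` of `|∇u(·,t)|` and `L` of `|Δω(·,t)|` (junk-free rendering of the two sup norms).
Typist's note: the viscous term enters with `+` as printed. [claim: Piromthan2025, status: under-review]
[cite: Piromthan2025, p.3 l.9–12] -/
def Step5_maxPrinciple : Prop :=
  ∀ (ν : ℝ) (u₀ : E3 → E3) (T : ℝ) (u : ℝ → E3 → E3) (p : ℝ → E3 → ℝ), 0 < ν → IsSol ν u₀ T u p →
    ∀ t ∈ Ico 0 T, ∃ D : ℝ, HasDerivWithinAt (W u) D (Ici t) t ∧
      ∀ G L : ℝ, (∀ x, ‖fderiv ℝ (u t) x‖ ≤ G) → (∀ x, ‖Δ (curl (u t)) x‖ ≤ L) → D ≤ G * W u t + ν * L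

/-- **Step 2′ — implicit in «d/dt W(t)» p.3 l.11 (rev 2)**: along every class solution `W(t) = ‖ω(t)‖_∞`
is a continuous function of `t ∈ [0,T)` (the print differentiates it). TRUE-type (slices vary smoothly with
locally uniform bounds in the class); typed as used by the T* comparison. [claim: Piromthan2025, status: under-review]
[cite: Piromthan2025, p.3 l.7–12; p.4 l.1–7] -/
def Step_Wcont : Prop :=
  ∀ (ν : ℝ) (u₀ : E3 → E3) (T : ℝ) (u : ℝ → E3 → E3) (p : ℝ → E3 → ℝ), 0 < ν → IsSol ν u₀ T u p →
    ContinuousOn (W u) (Ico 0 T)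

/-- **Display (5) p.3 l.13–16** «Substituting the bound ∥∇u∥L∞ ≤ CW(t), we have: d/dt W(t) ≤ CW(t)² +
ν∥∆ω(t)∥L∞» along every class solution (one constant `C > 0`).
[claim: Piromthan2025, status: under-review] [cite: Piromthan2025, (5) p.3 l.13–16] -/
def Step5 : Prop :=
  ∃ C : ℝ, 0 < C ∧
    ∀ (ν : ℝ) (u₀ : E3 → E3) (T : ℝ) (u : ℝ → E3 → E3) (p : ℝ → E3 → ℝ), 0 < ν → IsSol ν u₀ T u p →
      ∀ t ∈ Ico 0 T, ∃ D : ℝ, HasDerivWithinAt (W u) D (Ici t) t ∧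
        ∀ L : ℝ, (∀ x, ‖Δ (curl (u t)) x‖ ≤ L) → D ≤ C * W u t ^ 2 + ν * L

/-- **Step 3 — the printed inference (4) ∧ (maximum principle) ⇒ (5)** (p.3 l.13 «Substituting the
bound ∥∇u∥L∞ ≤ CW(t), we have»), typed as the implication.
[claim: Piromthan2025, status: under-review] [cite: Piromthan2025, p.3 l.13–16] -/
def Step45_subst : Prop := Step4_CZ → Step5_maxPrinciple → Step5

/-- **Display (6) p.3 l.29–36** «Substituting into (5), we obtain: d/dt W(t) ≤ C1W(t)² + (C2ν/δ(t)²)W(t),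
for constants C1, C2 > 0 depending only on the kernel bounds» along every class solution, with the
posited thickness `δ`. [claim: Piromthan2025, status: under-review] [cite: Piromthan2025, (6) p.3 l.29–36] -/
def Step6 (P : Posits) : Prop :=
  ∃ C₁ C₂ : ℝ, 0 < C₁ ∧ 0 < C₂ ∧
    ∀ (ν : ℝ) (u₀ : E3 → E3) (T : ℝ) (u : ℝ → E3 → E3) (p : ℝ → E3 → ℝ), 0 < ν → IsSol ν u₀ T u p →
      ∀ t ∈ Ico 0 T, ∃ D : ℝ, HasDerivWithinAt (W u) D (Ici t) t ∧
        D ≤ C₁ * W u t ^ 2 + C₂ * ν / P.δ u t ^ 2 * W u t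

/-- **Step 4 — the printed inference (5) ∧ (Laplacian posit) ⇒ (6)** (p.3 l.29 «Substituting into (5),
we obtain»), typed as the implication. [claim: Piromthan2025, status: under-review] [cite: Piromthan2025, p.3 l.17–36] -/
def Step56_subst (P : Posits) : Prop := Step5 → PositLap P → Step6 P

/-- **Step 6 — display (7) p.3 l.43–48** «For initial data where W(0) is large and δ(0) is small, the
nonlinear term dominates. Dropping the subdominant dissipation yields a Riccati-type inequality: d/dt W(t)
≥ AW(t)² − BW(t), for constants A, B > 0 explicitly computable from C1, C2, and the rate of δ(t)
decay»: for every `ν > 0` and every class solution whose datum passes the posited thresholds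
(`W(0) ≥ W₀`, `δ(0) ≤ d₀`), the constants `A = A(ν, α)`, `B = B(ν, α)` are positive and at every
`t ∈ [0,T)` the right derivative `D` of `W` exists with `A·W(t)² − B·W(t) ≤ D`. A LOWER bound; (5)–(6)
are upper bounds. [claim: Piromthan2025, status: under-review] [cite: Piromthan2025, (7) p.3 l.43–48; §4.3 p.5 l.22–27] -/
def Step7 (P : Posits) : Prop :=
  ∀ (ν : ℝ) (u₀ : E3 → E3) (T : ℝ) (u : ℝ → E3 → E3) (p : ℝ → E3 → ℝ), 0 < ν → IsSol ν u₀ T u p →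
    P.W₀ ν (P.α u) ≤ W u 0 → P.δ u 0 ≤ P.d₀ ν (P.α u) →
      0 < P.A ν (P.α u) ∧ 0 < P.B ν (P.α u) ∧
        ∀ t ∈ Ico 0 T, ∃ D : ℝ, HasDerivWithinAt (W u) D (Ici t) t ∧
          P.A ν (P.α u) * W u t ^ 2 - P.B ν (P.α u) * W u t ≤ D

/-- **Step 5 — the printed inference (6) ∧ (δ-decay) ⇒ (7)** (p.3 l.37–47 «Therefore, the second term
… grows only polynomially, while the first term grows quadratically … Dropping the subdominant
dissipation yields»), typed as the implication. [claim: Piromthan2025, status: under-review]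
[cite: Piromthan2025, p.3 l.37–48] -/
def Step67_dropping (P : Posits) : Prop := Step6 P → PositDecay P → Step7 P

/-- **Step 5 (rev 2) — the (6) ⇒ (7) passage p.3 l.37–48 AT THE REAL-FUNCTION GRAIN** (TYPING-HYGIENE 13 /
F15; REF-4 (d)): the print argues on the functions `W(t)`, `δ(t)` alone — «the second term in (6) grows only
polynomially, while the first term grows quadratically … Dropping the subdominant dissipation yields (7)», with
`A, B` «explicitly computable from C1, C2, and the rate of δ(t) decay» fixed BEFORE the function (here the
posited `A = P.A ν α`, `B = P.B ν α`, thresholds `P.W₀ ν α`, `P.d₀ ν α`): for all `C₁, C₂, ν, α > 0`, `A, B > 0`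
and every right-differentiable `w` and every `δ` with `δ(t) ≤ δ(0)e^{−αt}` obeying (6) on `[0,T)` with
`w(0) ≥ W₀`, `δ(0) ≤ d₀`: `A·w(t)² − B·w(t) ≤ w′(t)` on `[0,T)`. Implies the solution-grain face
(`step67_of_abs`). [claim: Piromthan2025, status: under-review] [cite: Piromthan2025, p.3 l.37–48] -/
def Step67_abs (P : Posits) : Prop :=
  ∀ (C₁ C₂ ν α : ℝ), 0 < C₁ → 0 < C₂ → 0 < ν → 0 < α →
    0 < P.A ν α ∧ 0 < P.B ν α ∧
      ∀ (T : ℝ) (w δ D : ℝ → ℝ),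
        (∀ t ∈ Ico 0 T, δ t ≤ δ 0 * Real.exp (-(α * t))) →
        (∀ t ∈ Ico 0 T, HasDerivWithinAt w (D t) (Ici t) t ∧ D t ≤ C₁ * w t ^ 2 + C₂ * ν / δ t ^ 2 * w t) →
          P.W₀ ν α ≤ w 0 → δ 0 ≤ P.d₀ ν α →
            ∀ t ∈ Ico 0 T, P.A ν α * w t ^ 2 - P.B ν α * w t ≤ D t

/-- **Glue (PROVED): the real-function grain implies the solution grain** — instantiate `Step67_abs` at
`w = W u`, `δ = P.δ u`, `α = P.α u` along a class solution. [cite: Piromthan2025, p.3 l.37–48] -/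
theorem step67_of_abs (P : Posits) (h : Step67_abs P) : Step67_dropping P := by
  intro h6 hD ν u₀ T u p hν hs hW hd
  obtain ⟨C₁, C₂, hC₁, hC₂, h6'⟩ := h6
  obtain ⟨hα, hdec⟩ := hD ν u₀ T u p hν hs
  choose D hDer using h6' ν u₀ T u p hν hs
  obtain ⟨hA, hB, habs⟩ := h C₁ C₂ ν (P.α u) hC₁ hC₂ hν hα
  refine ⟨hA, hB, fun t ht => ?_⟩
  have key := habs T (W u) (P.δ u) (fun r => if hr : r ∈ Ico 0 T then D r hr else 0) hdec
    (fun s hs' => by rw [dif_pos hs']; exact hDer s hs') hW hd t ht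
  refine ⟨_, ?_, key⟩
  rw [dif_pos ht]
  exact (hDer t ht).1

/-- **Step 7 — p.4 l.1–7 at the ODE grain (F15)** «The general solution to (7) blows up in finite time if
AW(0) > B, with blowup time bounded above by T∗ ≤ 1/(AW(0) − B)»: for `A, B > 0`, a real function `w`
with right derivative `≥ A·w² − B·w` at every point of `[0,T)` and `A·w(0) > B` forces
`T ≤ 1/(A·w(0) − B)`. TRUE-type (comparison with `z′ = z(Az − B)`, whose blow-up time
`B⁻¹ log(Aw₀/(Aw₀ − B))` is `≤ 1/(Aw₀ − B)`; `w` continuous on `[0,T)` with right derivatives — rev 2: the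
rev-1 face without `ContinuousOn` admitted jump-down functions on every `[0,T)`, a typing slip; the Summits-side
twin is `…Theorems.Piromthan2025Salvage.noncontinuation`, salvage-p6 g3 p537577).
[claim: Piromthan2025, status: under-review] [cite: Piromthan2025, p.4 l.1–7; §4.3 p.5 l.28–33] -/
def Step_Tstar : Prop :=
  ∀ (A B T : ℝ) (w D : ℝ → ℝ), 0 < A → 0 < B → ContinuousOn w (Ico 0 T) →
    (∀ t ∈ Ico 0 T, HasDerivWithinAt w (D t) (Ici t) t ∧ A * w t ^ 2 - B * w t ≤ D t) →
      B < A * w 0 → T ≤ 1 / (A * w 0 - B)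

/-- **Step 8 — §4 p.4 l.13–37 with §4.3 p.5 l.22–34** «We now construct a specific, explicit smooth
initial velocity field … uθ(r, z) = Γχδ(r, z) … Substituting our estimates into (7), we find that d/dt W(t)
≥ AW(t)² − BW(t), with W(0) ≳ Γ/δ0. For sufficiently small δ0 and large Γ, this ensures AW(0) > B»: for
every `ν > 0` some member `swirl Γ χ` of the printed family (χ a bump of §4) is a datum of the class and
EVERY class solution from it passes the thresholds of (7) with `A·W(0) > B`. (Typist's note: `swirl Γ χ`
is `C∞_c` and divergence free for every bump — TRUE; the load is the threshold/`AW(0) > B` clause, whose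
constants are the posits.) [claim: Piromthan2025, status: under-review] [cite: Piromthan2025, §4 p.4 l.13–37; §4.1 p.4 l.38–60; §4.3 p.5 l.22–34] -/
def Step43 (P : Posits) : Prop :=
  ∀ ν : ℝ, 0 < ν → ∃ (R δ Γ : ℝ) (χ : ℝ → ℝ → ℝ), IsBump R δ χ ∧ 0 < Γ ∧ IsDatum (swirl Γ χ) ∧
    ∀ (T : ℝ) (u : ℝ → E3 → E3) (p : ℝ → E3 → ℝ), IsSol ν (swirl Γ χ) T u p →
      P.W₀ ν (P.α u) ≤ W u 0 ∧ P.δ u 0 ≤ P.d₀ ν (P.α u) ∧ P.B ν (P.α u) < P.A ν (P.α u) * W u 0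

/-- **Step 9 — the local theory + Beale–Kato–Majda continuation presupposed by «the corresponding
solution … becomes singular in finite time T∗»** (p.7 l.61–63; [1] p.6 l.57–58; p.4 l.10 «classical
solutions must break down in finite time»): from every datum of the class, EITHER a global class solution
exists OR there are `T* > 0` and a class solution on `[0,T*)` whose vorticity is unbounded on `[0,T*)`.
Implicit; classical. [claim: Piromthan2025, status: under-review] [cite: Piromthan2025, p.7 l.61–63; p.6 l.57–58]
[cite: BealeKatoMajda1984, Thm. 1 and Corollary] -/
def Step_BKM : Prop :=
  ∀ ν : ℝ, 0 < ν → ∀ u₀ : E3 → E3, IsDatum u₀ →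
    (∃ (u : ℝ → E3 → E3) (p : ℝ → E3 → ℝ), IsGlobalSol ν u₀ u p) ∨
      ∃ (Ts : ℝ) (u : ℝ → E3 → E3) (p : ℝ → E3 → ℝ), 0 < Ts ∧ IsSol ν u₀ Ts u p ∧ VortBlowsUp u Ts

/-- **Step 10 — §5.1 p.6 l.1–33** «lim_{t→T∗} ∥u(t)∥Hs = ∞ for all s > 5/2. Hence, the classical
solution cannot be continued in Hs past T∗»: a class solution on `[0,T*)` with unbounded vorticity has
no classical extension. TRUE-type (an extension has bounded Sobolev norms, hence bounded vorticity, on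
the closed sub-slab `[0,T*]`). [claim: Piromthan2025, status: under-review] [cite: Piromthan2025, §5.1 p.6 l.1–33; §5.3 p.6 l.100–110] -/
def Step51 : Prop :=
  ∀ (ν : ℝ) (u₀ : E3 → E3) (Ts : ℝ) (u : ℝ → E3 → E3) (p : ℝ → E3 → ℝ), 0 < ν → IsSol ν u₀ Ts u p →
    VortBlowsUp u Ts → NoClassicalExtension ν u₀ Ts u

/-- **Step 11 — §5.2 p.6 l.34–94** «∫0^{T∗}∥∇u(s)∥²L2 ds ≳ ∫0^{T∗}∥ω(s)∥²L∞ δ(s)³ ds … since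
∥ω(s)∥L∞ ≳ 1/(T∗ − s) and δ(s)³ decays exponentially, this integral diverges … This contradicts the
energy inequality (8) … Therefore, the Leray–Hopf weak solution cannot be extended past T∗», typed at the
conclusion level as the printed inference: vorticity blow-up of a class solution on `[0,T*)` ⇒ no global
Leray–Hopf weak solution from `u₀` agrees with it on `[0,T*)`. Typist's flag: suspicious (tree
`leray_existence_R3_holds` + weak–strong uniqueness); conclusion-level. [claim: Piromthan2025, status: under-review]
[cite: Piromthan2025, §5.2 p.6 l.34–94; §5.3 p.6 l.111 – p.7 l.13] -/
def Step52 : Prop :=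
  ∀ (ν : ℝ) (u₀ : E3 → E3) (Ts : ℝ) (u : ℝ → E3 → E3) (p : ℝ → E3 → ℝ), 0 < ν → IsSol ν u₀ Ts u p →
    VortBlowsUp u Ts → NoLerayHopfExtension ν u₀ Ts u

/-- **§5.2 display (S1) p.6 l.63–80 (rev 2, REF-4 (h); records, not consumed)** «since ∥∇u(s)∥²L2 is at
least as large as the L∞-dominated portion of the energy on the support of ω, we estimate: ∫0^{T∗}∥∇u(s)∥²L2
ds ≳ ∫0^{T∗}∥ω(s)∥²L∞ δ(s)³ ds», typed slice-wise with the posited thickness: one constant `c > 0` with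
`c·W(s)²·δ(s)³ ≤ ‖∇u(s)‖²_{L²}` along every class solution. [claim: Piromthan2025, status: under-review]
[cite: Piromthan2025, §5.2 p.6 l.63–80] -/
def Step52_S1 (P : Posits) : Prop :=
  ∃ c : ℝ, 0 < c ∧
    ∀ (ν : ℝ) (u₀ : E3 → E3) (T : ℝ) (u : ℝ → E3 → E3) (p : ℝ → E3 → ℝ), 0 < ν → IsSol ν u₀ T u p →
      ∀ s ∈ Ico 0 T, ENNReal.ofReal (c * W u s ^ 2 * P.δ u s ^ 3) ≤ ∫⁻ x, ‖fderiv ℝ (u s) x‖ₑ ^ 2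

/-- **§5.2 display (S2) p.6 l.81–83 with §5.3 p.6 l.100–103 (rev 2, REF-4 (h); records, not consumed)** «since
∥ω(s)∥L∞ ≳ 1/(T∗ − s)» — «the maximum vorticity norm … blows up as t → T∗, satisfying a Riccati-type lower
bound»: at the real-function grain, for `A, B > 0` there is `c > 0` such that every continuous `w` on
`[0,T)` with right derivative `≥ A·w² − B·w` there and unbounded as `t ↑ T` satisfies `c/(T − s) ≤ w(s)`
on `[0,T)`. [claim: Piromthan2025, status: under-review] [cite: Piromthan2025, §5.2 p.6 l.81–83; §5.3 p.6 l.100–103] -/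
def Step52_S2 : Prop :=
  ∀ (A B : ℝ), 0 < A → 0 < B → ∃ c : ℝ, 0 < c ∧
    ∀ (T : ℝ) (w D : ℝ → ℝ), ContinuousOn w (Ico 0 T) →
      (∀ t ∈ Ico 0 T, HasDerivWithinAt w (D t) (Ici t) t ∧ A * w t ^ 2 - B * w t ≤ D t) →
        (∀ M : ℝ, ∃ s ∈ Ico 0 T, M < w s) → ∀ s ∈ Ico 0 T, c / (T - s) ≤ w s

/-! ## E. Kernel relations (pure logic; nothing of the paper asserted) -/

/-- A global class solution restricts to a class solution on every `[0,T)`, `T > 0` (definitional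
unfolding of `IsGlobalSol`). [cite: Piromthan2025, p.1 l.28–30] -/
theorem IsGlobalSol.isSol {ν : ℝ} {u₀ : E3 → E3} {u : ℝ → E3 → E3} {p : ℝ → E3 → ℝ}
    (h : IsGlobalSol ν u₀ u p) {T : ℝ} (hT : 0 < T) : IsSol ν u₀ T u p := h T hT

/-- **(7) + the T* bound + the §4.3 thresholds bound the lifespan of EVERY class solution from the §4.3
datum**: `T ≤ 1/(A·W(0) − B)`. [cite: Piromthan2025, p.4 l.1–12; §4.3 p.5 l.22–34] -/
theorem lifespan_le (P : Posits) (h7 : Step7 P) (hT : Step_Tstar) (hWc : Step_Wcont) {ν : ℝ} (hν : 0 < ν)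
    {u₀ : E3 → E3} {T : ℝ} {u : ℝ → E3 → E3} {p : ℝ → E3 → ℝ} (hs : IsSol ν u₀ T u p)
    (hW : P.W₀ ν (P.α u) ≤ W u 0) (hd : P.δ u 0 ≤ P.d₀ ν (P.α u))
    (hAB : P.B ν (P.α u) < P.A ν (P.α u) * W u 0) :
    T ≤ 1 / (P.A ν (P.α u) * W u 0 - P.B ν (P.α u)) := by
  obtain ⟨hA, hB, hR⟩ := h7 ν u₀ T u p hν hs hW hd
  choose D hD using hR
  refine hT (P.A ν (P.α u)) (P.B ν (P.α u)) T (W u)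
    (fun t => if ht : t ∈ Ico 0 T then D t ht else 0) hA hB (hWc ν u₀ T u p hν hs) (fun t ht => ?_) hAB
  rw [dif_pos ht]
  exact hD t ht

/-- **COMPOSITION (PROVED)** — the printed chain p.2–p.7 composes: the displays (4), (5), (6), the
posits, (7), the T* bound, the §4.3 datum, the presupposed local/BKM theory and §5.1/§5.2 yield the
p.7 statement. Binders = the rev-1 list in dependency order (module docstring) with the rev-2 continuity
face `Step_Wcont` inserted after the maximum-principle line (CHAIR 14:28Z (1)(iii)). Logic: from the §4.3
datum, `Step_BKM` gives a global class solution or a blow-up; a global one restricted to `[0,T₁+1)`,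
`T₁ = 1/(A·W(0) − B)`, contradicts `lifespan_le`; the blow-up branch is the conclusion with §5.1/§5.2.
[cite: Piromthan2025, §§2–5 pp.2–7; p.7 l.52–65] -/
theorem claim_of_steps (P : Posits) (h4 : Step4_CZ) (h5m : Step5_maxPrinciple) (hWc : Step_Wcont)
    (h45 : Step45_subst) (hL : PositLap P) (h56 : Step56_subst P) (hD : PositDecay P)
    (h67 : Step67_dropping P) (hT : Step_Tstar) (h43 : Step43 P) (hBKM : Step_BKM) (h51 : Step51)
    (h52 : Step52) : ClaimedTheorem := by
  have h7 : Step7 P := h67 (h56 (h45 h4 h5m) hL) hD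
  intro ν hν
  obtain ⟨R, δ, Γ, χ, -, -, hdat, hall⟩ := h43 ν hν
  refine ⟨swirl Γ χ, hdat, ?_⟩
  rcases hBKM ν hν (swirl Γ χ) hdat with ⟨u, p, hg⟩ | ⟨Ts, u, p, hTs, hs, hblow⟩
  · -- a global class solution contradicts the lifespan bound
    exfalso
    set T₁ : ℝ := 1 / (P.A ν (P.α u) * W u 0 - P.B ν (P.α u)) with hT₁
    have hpos : 0 < max T₁ 0 + 1 := by positivity
    have hs := hg.isSol hpos
    obtain ⟨hW, hd, hAB⟩ := hall (max T₁ 0 + 1) u p hs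
    have hle := lifespan_le P h7 hT hWc hν hs hW hd hAB
    rw [← hT₁] at hle
    linarith [le_max_left T₁ 0]
  · exact ⟨Ts, u, p, hTs, hs, hblow, h51 ν _ Ts u p hν hs hblow, h52 ν _ Ts u p hν hs hblow⟩

/-- **COMPOSITION with the real-function grain of the (6) ⇒ (7) passage as binder 5** (rev 2; `Step67_abs P`
in place of `Step67_dropping P`, through the glue `step67_of_abs`). [cite: Piromthan2025, p.3 l.37–48; §§2–5 pp.2–7] -/
theorem claim_of_steps_abs (P : Posits) (h4 : Step4_CZ) (h5m : Step5_maxPrinciple) (hWc : Step_Wcont)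
    (h45 : Step45_subst) (hL : PositLap P) (h56 : Step56_subst P) (hD : PositDecay P) (h67 : Step67_abs P)
    (hT : Step_Tstar) (h43 : Step43 P) (hBKM : Step_BKM) (h51 : Step51) (h52 : Step52) :
    ClaimedTheorem :=
  claim_of_steps P h4 h5m hWc h45 hL h56 hD (step67_of_abs P h67) hT h43 hBKM h51 h52

/-! ## F. Clay link (PROVED): the claim as typed decides Clay (C) -/

/-- A `C∞_c` datum is of Clay's class (4) (tree `SupNormCZ.hasRapidSpatialDecay_of_hasCompactSupport`).
[cite: FeffermanClay2006, (4) p. 1] -/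
theorem IsDatum.hasRapidSpatialDecay {u₀ : E3 → E3} (h : IsDatum u₀) : HasRapidSpatialDecay u₀ :=
  Barriers.NavierStokesRegularity.SupNormCZ.hasRapidSpatialDecay_of_hasCompactSupport h.1 h.2.2

/-- **`ClaimedTheorem → Clay (C)`** (`clayR3.Breakdown` = the leaf `NavierStokesBreakdownR3`,
`clayR3_breakdown_iff`): at `ν = 1` the class solution on `[0,T*)` with unbounded vorticity is a vorticity
sup-norm blow-up certificate for a datum of class (4) (tree
`navierStokesBreakdownR3_of_vorticitySupCertificate`: Tao's uniqueness of finite-energy smooth solutions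
+ boundedness of the Clay solution's derivatives on closed slabs). The extension clauses are not used.
[cite: FeffermanClay2006, (C) p. 2] [cite: Piromthan2025, p.7 l.54–55] -/
theorem clay_of_claimed (h : ClaimedTheorem) : ClayVariants.clayR3.Breakdown := by
  obtain ⟨u₀, hdat, Ts, u, p, -, hs, hblow, -, -⟩ := h 1 one_pos
  exact clayR3_breakdown_iff.mpr
    (navierStokesBreakdownR3_of_vorticitySupCertificate one_pos hdat.1 hdat.2.1 hdat.hasRapidSpatialDecay
      hs.classical hs.initial hs.energy hblow)

/-- With the steps, Clay (C). [cite: FeffermanClay2006, (C) p. 2] -/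
theorem clay_of_steps (P : Posits) (h4 : Step4_CZ) (h5m : Step5_maxPrinciple) (hWc : Step_Wcont)
    (h45 : Step45_subst) (hL : PositLap P) (h56 : Step56_subst P) (hD : PositDecay P)
    (h67 : Step67_dropping P) (hT : Step_Tstar) (h43 : Step43 P) (hBKM : Step_BKM) (h51 : Step51)
    (h52 : Step52) : ClayVariants.clayR3.Breakdown :=
  clay_of_claimed (claim_of_steps P h4 h5m hWc h45 hL h56 hD h67 hT h43 hBKM h51 h52)

/-! ## G. Discharges (rev 3, D-0026; append-only theorems — `Step51`, `Step45_subst`, `Step_Tstar`) -/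

/-- In the class, the vorticity of a slice `u(·,t)`, `t < T`, is bounded (Sobolev embedding on the closed
sub-slab `[0,(t+T)/2]`). [cite: Piromthan2025, §3 p.3 l.7–8] -/
theorem IsSol.exists_enorm_curl_le {ν : ℝ} {u₀ : E3 → E3} {T : ℝ} {u : ℝ → E3 → E3} {p : ℝ → E3 → ℝ}
    (hs : IsSol ν u₀ T u p) {t : ℝ} (ht : t ∈ Ico 0 T) :
    ∃ R : ℝ≥0∞, R < ⊤ ∧ ∀ x, ‖curl (u t) x‖ₑ ≤ R := by
  have hT'' : (t + T) / 2 < T := by linarith [ht.2]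
  have htI : t ∈ Icc 0 ((t + T) / 2) := ⟨ht.1, by linarith [ht.2]⟩
  have hsub : Icc 0 ((t + T) / 2) ⊆ Ico 0 T := fun s hs' => ⟨hs'.1, hs'.2.trans_lt hT''⟩
  obtain ⟨R, hR, hb⟩ := exists_enorm_curl_le_of_hasBoundedSobolevNormsOn
    (fun s hs' => hs.classical.contDiff_velocity (hsub hs')) (hs.sobolev _ hT'')
  exact ⟨R, hR, hb t htI⟩

/-- In the class, `‖ω(x,t)‖ ≤ W(t)` for `t < T` (the supremum is finite). [cite: Piromthan2025, §3 p.3 l.7–8] -/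
theorem IsSol.norm_curl_le_W {ν : ℝ} {u₀ : E3 → E3} {T : ℝ} {u : ℝ → E3 → E3} {p : ℝ → E3 → ℝ}
    (hs : IsSol ν u₀ T u p) {t : ℝ} (ht : t ∈ Ico 0 T) (x : E3) : ‖curl (u t) x‖ ≤ W u t := by
  obtain ⟨R, hR, hb⟩ := hs.exists_enorm_curl_le ht
  have hsup : vortSup u t ≤ R := iSup_le hb
  have hne : vortSup u t ≠ ⊤ := ne_top_of_le_ne_top hR.ne hsup
  have hle : ‖curl (u t) x‖ₑ ≤ vortSup u t := le_iSup (fun y => ‖curl (u t) y‖ₑ) x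
  have := ENNReal.toReal_mono hne hle
  simpa [W] using this

/-- The slices of a class solution are `H^∞` divergence-free fields (`Chae2007.IsDatum`).
[cite: Piromthan2025, §5.1 p.6 l.1–10] -/
theorem IsSol.isDatum_slice {ν : ℝ} {u₀ : E3 → E3} {T : ℝ} {u : ℝ → E3 → E3} {p : ℝ → E3 → ℝ}
    (hs : IsSol ν u₀ T u p) {t : ℝ} (ht : t ∈ Ico 0 T) : Chae2007.IsDatum (u t) := by
  have hT'' : (t + T) / 2 < T := by linarith [ht.2]
  have htI : t ∈ Icc 0 ((t + T) / 2) := ⟨ht.1, by linarith [ht.2]⟩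
  refine ⟨hs.classical.contDiff_velocity ht, hs.classical.divFree t ht, fun n => ?_⟩
  obtain ⟨C, hC⟩ := hs.sobolev _ hT'' n
  exact (hC t htI).trans_lt ENNReal.coe_lt_top

/-- **Step 10 (§5.1) DISCHARGED**: a class solution with unbounded vorticity on `[0,T*)` has no classical
extension — an extension has bounded vorticity on the closed sub-slab `[0,T*]`. [cite: Piromthan2025, §5.1 p.6 l.1–33] -/
theorem step51_holds : Step51 := by
  intro ν u₀ Ts u p hν hs hblow ⟨T, v, q, hTs, hv, hagree⟩
  obtain ⟨R, hR, hb⟩ := exists_enorm_curl_le_of_hasBoundedSobolevNormsOn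
    (fun s hs' => hv.classical.contDiff_velocity ⟨hs'.1, hs'.2.trans_lt hTs⟩) (hv.sobolev Ts hTs)
  obtain ⟨t, ht, x, hx⟩ := hblow R.toReal
  have h1 : ‖curl (v t) x‖ₑ ≤ R := hb t ⟨ht.1, ht.2.le⟩ x
  have h2 : ‖curl (v t) x‖ ≤ R.toReal := by
    have := ENNReal.toReal_mono hR.ne h1
    simpa using this
  rw [hagree t ht] at h2
  exact lt_irrefl _ (hx.trans_le h2)

/-- **Step 3 (the substitution (4) ∧ max-principle ⇒ (5)) DISCHARGED**: apply (4) to the slice `u(·,t)`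
(an `H^∞` divergence-free field) with the vorticity bound `W(t)`. [cite: Piromthan2025, p.3 l.13–16] -/
theorem step45_subst_holds : Step45_subst := by
  intro h4 h5m
  obtain ⟨C, hC, hCZ⟩ := h4
  refine ⟨C, hC, fun ν u₀ T u p hν hs t ht => ?_⟩
  obtain ⟨D, hD, hbd⟩ := h5m ν u₀ T u p hν hs t ht
  refine ⟨D, hD, fun L hL => ?_⟩
  have hG : ∀ x, ‖fderiv ℝ (u t) x‖ ≤ C * W u t :=
    hCZ (u t) (hs.isDatum_slice ht) (W u t) (fun y => hs.norm_curl_le_W ht y)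
  have := hbd (C * W u t) L hG hL
  nlinarith [this]

/-- **The damped-Riccati non-continuation lemma behind p.4 l.1–7** (ODE grain): a continuous `w` on
`[0,T)` with right derivative `≥ A·w² − B·w` and `A·w(0) > B` cannot live past `1/(A·w(0) − B)`.
Proof: `w ≥ w(0)` (comparison with the constant), then `w ≥ φ`, `φ(t) = 1/(1/w(0) − c t)`,
`c = (A·w(0) − B)/w(0)` (comparison: `φ′ = cφ² ≤ A·φ² − B·φ` where `φ ≥ w(0)`), and `φ ↑ ∞` at
`1/(A·w(0) − B)` while `w` is bounded on the compact sub-slab. [cite: Piromthan2025, p.4 l.1–7] -/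
theorem riccati_noncontinuation (A B T : ℝ) (w D : ℝ → ℝ) (hA : 0 < A) (hB : 0 < B)
    (hc : ContinuousOn w (Ico 0 T))
    (hd : ∀ t ∈ Ico 0 T, HasDerivWithinAt w (D t) (Ici t) t ∧ A * w t ^ 2 - B * w t ≤ D t)
    (h0 : B < A * w 0) : T ≤ 1 / (A * w 0 - B) := by
  by_contra hT
  have hT : 1 / (A * w 0 - B) < T := lt_of_not_ge hT
  set w₀ := w 0 with hw₀
  set κ := A * w₀ - B with hκ
  have hκ0 : 0 < κ := by linarith
  have hw₀pos : 0 < w₀ := by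
    by_contra hneg
    have hneg : w₀ ≤ 0 := le_of_not_gt hneg
    nlinarith
  set T₁ := 1 / κ with hT₁
  have hT₁pos : 0 < T₁ := by positivity
  -- a blow-up time strictly between `T₁` and `T`
  set T' := (T₁ + min T (2 * T₁)) / 2 with hT'
  have hT'gt : T₁ < T' := by
    have : T₁ < min T (2 * T₁) := lt_min hT (by linarith)
    linarith
  have hT'lt : T' < T := by
    have : min T (2 * T₁) ≤ T := min_le_left _ _
    linarith
  have hT'pos : 0 < T' := hT₁pos.trans hT'gt
  -- the comparison rate `c' = 1/(w₀ T') < κ/w₀`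
  set c := 1 / (w₀ * T') with hcdef
  have hcpos : 0 < c := by positivity
  have hcT' : c * T' = 1 / w₀ := by rw [hcdef]; field_simp
  have hclt : c * w₀ < κ := by
    have h1 : c * w₀ = 1 / T' := by rw [hcdef]; field_simp
    rw [h1, div_lt_iff₀ hT'pos]
    have h2 : κ * T₁ = 1 := by rw [hT₁]; field_simp
    nlinarith
  -- `w` is bounded on the compact `[0, T'] ⊂ [0, T)`
  have hcI : ContinuousOn w (Icc 0 T') := hc.mono fun s hs' => ⟨hs'.1, hs'.2.trans_lt hT'lt⟩
  obtain ⟨M, hM⟩ := (isCompact_Icc : IsCompact (Icc (0 : ℝ) T')).exists_bound_of_continuousOn hcI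
  -- choose `b < T'` with `φ b ≥ |M| + 1`
  set ε := min (T' / 2) (1 / (c * (|M| + 1))) with hε
  have hM1 : 0 < |M| + 1 := by positivity
  have hεpos : 0 < ε := lt_min (by positivity) (by positivity)
  have hεle : ε ≤ T' / 2 := min_le_left _ _
  have hεle' : ε ≤ 1 / (c * (|M| + 1)) := min_le_right _ _
  set b := T' - ε with hbdef
  have hb0 : 0 < b := by linarith
  have hbT' : b < T' := by linarith
  have hbT : b < T := hbT'.trans hT'lt
  -- the comparison function `φ t = (1/w₀ − c t)⁻¹`
  set φ : ℝ → ℝ := fun t => (1 / w₀ - c * t)⁻¹ with hφ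
  have hden : ∀ t ∈ Icc 0 b, 0 < 1 / w₀ - c * t := by
    intro t ht
    have h1 : c * t ≤ c * b := mul_le_mul_of_nonneg_left ht.2 hcpos.le
    have hcb : c * b = 1 / w₀ - c * ε := by rw [hbdef, mul_sub, hcT']
    nlinarith [mul_pos hcpos hεpos]
  have hden_le : ∀ t ∈ Icc 0 b, 1 / w₀ - c * t ≤ 1 / w₀ := by
    intro t ht
    nlinarith [mul_nonneg hcpos.le ht.1]
  have hφge : ∀ t ∈ Icc 0 b, w₀ ≤ φ t := by
    intro t ht
    calc w₀ = (1 / w₀)⁻¹ := by rw [one_div, inv_inv]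
      _ ≤ (1 / w₀ - c * t)⁻¹ := inv_anti₀ (hden t ht) (hden_le t ht)
  have hφderiv : ∀ t ∈ Ico 0 b, HasDerivWithinAt φ (c * φ t ^ 2) (Ici t) t := by
    intro t ht
    have hd0 : 1 / w₀ - c * t ≠ 0 := (hden t ⟨ht.1, ht.2.le⟩).ne'
    have h1 : HasDerivAt (fun s => 1 / w₀ - c * s) (-c) t := by
      simpa using ((hasDerivAt_id t).const_mul c).const_sub (1 / w₀)
    have h2 := h1.inv hd0
    have heq : c * φ t ^ 2 = -(-c) / (1 / w₀ - c * t) ^ 2 := by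
      simp only [hφ, inv_pow, neg_neg, div_eq_mul_inv]
    rw [heq]
    exact h2.hasDerivWithinAt
  have hφcont : ContinuousOn φ (Icc 0 b) := by
    refine ContinuousOn.inv₀ (by fun_prop) fun t ht => (hden t ht).ne'
  have hφ0 : φ 0 = w₀ := by simp [hφ]
  -- comparison: `φ ≤ w` on `[0, b]`
  have stage2 : ∀ x ∈ Icc 0 b, φ x ≤ w x := by
    have hcIb : ContinuousOn w (Icc 0 b) := hc.mono fun s hs' => ⟨hs'.1, hs'.2.trans_lt hbT⟩
    refine fun x hx => image_le_of_deriv_right_lt_deriv_boundary' hφcont hφderiv (by rw [hφ0])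
      hcIb (fun x hx' => (hd x ⟨hx'.1, hx'.2.trans hbT⟩).1) ?_ hx
    intro x hx' heq
    have hlow := (hd x ⟨hx'.1, hx'.2.trans hbT⟩).2
    have hφx : w₀ ≤ φ x := hφge x ⟨hx'.1, hx'.2.le⟩
    rw [← heq] at hlow
    have hφpos : 0 < φ x := hw₀pos.trans_le hφx
    -- `c φ² < A φ² − B φ` because `(A − c) φ ≥ (A − c) w₀ > B`
    have h1 : B < (A - c) * w₀ := by nlinarith
    have h2 : (A - c) * w₀ ≤ (A - c) * φ x := by
      have hAc : 0 ≤ A - c := by nlinarith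
      exact mul_le_mul_of_nonneg_left hφx hAc
    nlinarith
  -- contradiction at `b`
  have hwb : w b ≤ M := (le_abs_self _).trans ((Real.norm_eq_abs _).symm.le.trans (hM b ⟨hb0.le, hbT'.le⟩))
  have hφb : φ b = (c * ε)⁻¹ := by
    simp only [hφ, hbdef, mul_sub, hcT']
    ring_nf
  have hφbig : |M| + 1 ≤ φ b := by
    rw [hφb, ← one_div, le_div_iff₀ (mul_pos hcpos hεpos)]
    have := mul_le_mul_of_nonneg_left hεle' (mul_pos hcpos hM1).le
    calc (|M| + 1) * (c * ε) = (c * (|M| + 1)) * ε := by ring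
      _ ≤ (c * (|M| + 1)) * (1 / (c * (|M| + 1))) := this
      _ = 1 := by field_simp
  have := stage2 b ⟨hb0.le, le_refl _⟩
  linarith [le_abs_self M]


/-- **Step 7 (`Step_Tstar`, the T* bound p.4 l.1–7) DISCHARGED** (rev 3, D-0026): `riccati_noncontinuation`.
[cite: Piromthan2025, p.4 l.1–7] -/
theorem step_Tstar_holds : Step_Tstar :=
  fun A B T w D hA hB hc hd h0 => riccati_noncontinuation A B T w D hA hB hc hd h0

/-! ## H. Discharges (rev 4, ns-claims-lit-3 g9, D-0026; append-only theorems — `Step_Wcont`, `Step_BKM`;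
custodian consent typist-2 g7 15:02:10Z). With §G every classical / implicit binder of `claim_of_steps` is
now a kernel theorem (`Step_Wcont`, `Step45_subst`, `Step_Tstar`, `Step_BKM`, `Step51`); the composition
re-stated on the remaining binders is `claim_of_open_steps` below (refuted head `Step4_CZ`, the
maximum-principle line, the posits and posit-dependent inferences, `Step43 P`, `Step52`). Nothing above is
changed; no `def` is added. -/

/-- **Step 2′ (`Step_Wcont`) DISCHARGED (kernel)**: along a class solution `W(t) = ‖ω(t)‖_∞` is continuous
on `[0,T)` — the vorticity is time-Lipschitz in sup norm on every closed sub-slab of the Beale–Kato–Majda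
class (tree `IsClassicalNSSolutionOn.continuousOn_toReal_iSup_enorm_curl_Ico`,
`Literature/Analysis/FluidPDE/BKMClassVorticitySupLipschitz.lean`: `curl ∂ₜu = νΔω − (u·∇)ω + (ω·∇)u` is
bounded on the slab by the Sobolev imbedding, then the mean value inequality along time lines).
[cite: MajdaBertozziCUP2002, §3.2.2 Thm. 3.5 (PDF p. 92)] [cite: Piromthan2025, p.3 l.7–12; p.4 l.1–7] -/
theorem step_Wcont_holds : Step_Wcont := fun _ν _u₀ _T _u _p _hν hs =>
  hs.classical.continuousOn_toReal_iSup_enorm_curl_Ico hs.sobolev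

/-- All derivatives of a `C∞_c` datum are in `L²` (via Clay's class (4)). [cite: Piromthan2025, p.1 l.26] -/
theorem IsDatum.lintegral_iteratedFDeriv_sq_lt_top {u₀ : E3 → E3} (h : IsDatum u₀) (n : ℕ) :
    ∫⁻ x, ‖iteratedFDeriv ℝ n u₀ x‖ₑ ^ 2 < ⊤ :=
  h.hasRapidSpatialDecay.lintegral_enorm_iteratedFDeriv_sq_lt_top (μ := volume) n

/-- The class's energy clause on `[0,T)` from the Sobolev bounds on the closed sub-slabs and Tao's
horizon-uniform energy inequality `∫|u(t)|² ≤ C ∫|u₀|²` (Tao 2013 Lemma 8.1, tree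
`tao_finite_energy_smooth_energy_bound_holds`; the constant does not depend on the sub-slab).
[cite: Tao2011, Lemma 8.1 (arXiv Lemma 44)] [cite: Piromthan2025, (8) p.6 l.41–55] -/
theorem energy_of_sobolev {ν : ℝ} (hν : 0 < ν) {T : ℝ} {u : ℝ → E3 → E3} {p : ℝ → E3 → ℝ}
    (hcl : IsClassicalNSSolutionOn (Ico 0 T) ν 0 u p)
    (hB : ∀ T'' < T, HasBoundedSobolevNormsOn (Icc 0 T'') u) :
    ∃ A : ℝ≥0∞, A < ⊤ ∧ ∀ t ∈ Ico 0 T, ∫⁻ x, ‖u t x‖ₑ ^ 2 ≤ A := by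
  obtain ⟨C, hC, hTao⟩ := tao_finite_energy_smooth_energy_bound_holds
  rcases le_or_gt T 0 with hT | hT
  · exact ⟨0, ENNReal.zero_lt_top, fun t ht => absurd (ht.1.trans_lt ht.2) (not_lt.2 hT)⟩
  obtain ⟨C₀, hC₀⟩ := hB (T / 2) (by linarith) 0
  refine ⟨C * C₀, ENNReal.mul_lt_top hC ENNReal.coe_lt_top, fun t ht => ?_⟩
  set T'' : ℝ := (t + T) / 2 with hT''
  have htT'' : t ≤ T'' := by rw [hT'']; linarith [ht.2]
  have hT''T : T'' < T := by rw [hT'']; linarith [ht.2]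
  have hT''0 : 0 < T'' := by rw [hT'']; linarith [ht.1, ht.2]
  have hclI : IsClassicalNSSolutionOn (Icc 0 T'') ν 0 u p :=
    hcl.mono (Icc_subset_Ico_right hT''T) (uniqueDiffOn_Icc hT''0)
  obtain ⟨C'', hC''⟩ := hB T'' hT''T 0
  have hEI : ∃ A : ℝ≥0∞, A < ⊤ ∧ ∀ s ∈ Icc 0 T'', ∫⁻ x, ‖u s x‖ₑ ^ 2 ≤ A := by
    refine ⟨C'', ENNReal.coe_lt_top, fun s hs => ?_⟩
    refine le_of_eq_of_le (lintegral_congr fun x => ?_) (hC'' s hs)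
    rw [← ofReal_norm, ← ofReal_norm, norm_iteratedFDeriv_zero]
  have h1 := (hTao ν T'' hν hT''0 u p hclI hEI).1 t ⟨ht.1, htT''⟩
  refine h1.trans ?_
  gcongr
  refine le_of_eq_of_le (lintegral_congr fun x => ?_) (hC₀ 0 ⟨le_rfl, by linarith⟩)
  rw [← ofReal_norm, ← ofReal_norm, norm_iteratedFDeriv_zero]

/-- Unbounded vorticity on `[0,T) × ℝ³` from an infinite Beale–Kato–Majda integral `∫₀ᵀ sup|ω| = ∞`
(a bounded vorticity would make the lower integral over `(0,T)` finite). [cite: BealeKatoMajda1984, Thm. 1]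
[cite: Piromthan2025, p.4 l.8–9] -/
theorem vortBlowsUp_of_lintegral_eq_top {u : ℝ → E3 → E3} {T : ℝ}
    (h : (∫⁻ t in Ioo 0 T, ⨆ x, ‖curl (u t) x‖ₑ) = ⊤) : VortBlowsUp u T := by
  intro M
  by_contra hcon
  push Not at hcon
  have hle : (∫⁻ t in Ioo 0 T, ⨆ x, ‖curl (u t) x‖ₑ) ≤ ∫⁻ _ in Ioo (0 : ℝ) T, ENNReal.ofReal M := by
    refine setLIntegral_mono measurable_const fun t ht => ?_
    refine iSup_le fun x => ?_
    rw [← ofReal_norm]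
    exact ENNReal.ofReal_le_ofReal (hcon t ⟨ht.1.le, ht.2⟩ x)
  have hfin : (∫⁻ _ in Ioo (0 : ℝ) T, ENNReal.ofReal M) < ⊤ := by
    rw [setLIntegral_const]
    exact ENNReal.mul_lt_top ENNReal.ofReal_lt_top measure_Ioo_lt_top
  exact absurd h (ne_of_lt (hle.trans_lt hfin))

/-- **Step 9 (`Step_BKM`, the local theory + Beale–Kato–Majda dichotomy, p.7 l.61 / [1]) DISCHARGED
(kernel)**: for a `C∞_c` divergence-free datum EITHER a global class solution exists OR a class solution on
some `[0,T*)` has unbounded vorticity — the tree's maximal-solution alternative in the Beale–Kato–Majda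
class `exists_global_bkmClass_or_blowup` (Majda–Bertozzi 2002 Thm. 3.6 / Cor. 3.2, BKM 1984 Thm. 1: the
blow-up branch carries `∫₀^{T*} sup|ω| = ∞`), with the class's energy clause supplied by
`energy_of_sobolev` (Tao 2013 Lemma 8.1). [cite: MajdaBertozzi2002, Thm. 3.6 (pp. 115–117), Cor. 3.2 (p. 112)]
[cite: BealeKatoMajda1984, Thm. 1 and Corollary] [cite: Piromthan2025, p.7 l.61; §5.1 p.6 l.1–10] -/
theorem step_BKM_holds : Step_BKM := by
  intro ν hν u₀ hu₀
  have hdiv : VectorCalculus.IsDivFree u₀ := hu₀.2.1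
  rcases exists_global_bkmClass_or_blowup hν.le hu₀.1 hdiv hu₀.lintegral_iteratedFDeriv_sq_lt_top with
    ⟨u, p, hu, hu0, hB, -⟩ | ⟨Ts, hTs, u, p, hu, hu0, hreg, -, -, htop, -⟩
  · refine Or.inl ⟨u, p, fun T _hT => ?_⟩
    have hcl : IsClassicalNSSolutionOn (Ico 0 T) ν 0 u p :=
      hu.mono Ico_subset_Ici_self (uniqueDiffOn_Ico 0 T)
    have hB' : ∀ T'' < T, HasBoundedSobolevNormsOn (Icc 0 T'') u := fun T'' _ => hB T''
    exact ⟨hcl, hu0, energy_of_sobolev hν hcl hB', hB'⟩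
  · exact Or.inr ⟨Ts, u, p, hTs, ⟨hu, hu0, energy_of_sobolev hν hu hreg, hreg⟩,
      vortBlowsUp_of_lintegral_eq_top htop⟩

/-- **COMPOSITION on the open binders only** (rev 4): with `Step_Wcont`, `Step45_subst`, `Step_Tstar`,
`Step_BKM`, `Step51` discharged, the printed chain stands or falls with the refuted head `Step4_CZ`, the
maximum-principle line `Step5_maxPrinciple`, the posits `PositLap P` / `PositDecay P` and the
posit-dependent inferences `Step56_subst P` / `Step67_dropping P`, the datum step `Step43 P`, and the
conclusion-level `Step52`. PROVED, pure logic; nothing asserted. [cite: Piromthan2025, §3–§5 pp.3–7] -/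
theorem claim_of_open_steps (P : Posits) (h4 : Step4_CZ) (h5m : Step5_maxPrinciple) (hL : PositLap P)
    (h56 : Step56_subst P) (hD : PositDecay P) (h67 : Step67_dropping P) (h43 : Step43 P) (h52 : Step52) :
    ClaimedTheorem :=
  claim_of_steps P h4 h5m step_Wcont_holds step45_subst_holds hL h56 hD h67 step_Tstar_holds h43
    step_BKM_holds step51_holds h52

/-- `clay_of_steps` on the open binders only (rev 4). [cite: FeffermanClay2006, (C) p. 2] -/
theorem clay_of_open_steps (P : Posits) (h4 : Step4_CZ) (h5m : Step5_maxPrinciple) (hL : PositLap P)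
    (h56 : Step56_subst P) (hD : PositDecay P) (h67 : Step67_dropping P) (h43 : Step43 P) (h52 : Step52) :
    ClayVariants.clayR3.Breakdown :=
  clay_of_claimed (claim_of_open_steps P h4 h5m hL h56 hD h67 h43 h52)

/-! ## I. Rev 5 — D-0026 discharge of the printed inference (5) ∧ (Laplacian posit) ⇒ (6)

Typist of record / custodian ns-claims-typist-2 g7 (ANNOUNCE-FIRST 15:18:05Z), append-only on rev 4: the
substitution step `Step56_subst P` (p.3 l.29 «Substituting into (5), we obtain (6)») is pure algebra —
feed the posited Laplacian bound `‖Δω(t)‖_∞ ≤ (C′/δ(t)²) W(t)` into the `∀ L`-clause of (5) and rename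
the constants (`C₁ := C`, `C₂ := max C′ 1`, so that `C₂ > 0` as (6) prints even when the posited `C′` is
not positive). Nothing above is changed; no `def` is added. -/

/-- `W u t = ‖ω(t)‖_∞` (as a real number) is nonnegative. [cite: Piromthan2025, p.3 l.7–8] -/
theorem W_nonneg (u : ℝ → E3 → E3) (t : ℝ) : 0 ≤ W u t := ENNReal.toReal_nonneg

/-- **Step 4 (`Step56_subst P`) DISCHARGED (kernel)** for every posit package `P`: display (5) together
with the Laplacian posit «‖Δω(t)‖_∞ ≤ (C′/δ(t)²)W(t)» (p.3 l.17–28) yields display (6) with `C₁ := C`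
and `C₂ := max C′ 1` — the printed «Substituting into (5), we obtain» (p.3 l.29), verbatim algebra.
TRUE column; the posit itself (`PositLap P`) stays a referee object.
[cite: Piromthan2025, (5) p.3 l.13–16; p.3 l.17–29; (6) p.3 l.29–36] -/
theorem step56_subst_holds (P : Posits) : Step56_subst P := by
  intro h5 hL
  obtain ⟨C, hC, h5⟩ := h5
  refine ⟨C, max P.Cp 1, hC, lt_of_lt_of_le one_pos (le_max_right _ _), ?_⟩
  intro ν u₀ T u p hν hs t ht
  obtain ⟨D, hD, hDle⟩ := h5 ν u₀ T u p hν hs t ht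
  obtain ⟨hδ, hLap⟩ := hL ν u₀ T u p hν hs t ht
  refine ⟨D, hD, ?_⟩
  have hW : 0 ≤ W u t := W_nonneg u t
  have hδ2 : 0 < P.δ u t ^ 2 := pow_pos hδ 2
  have h1 : D ≤ C * W u t ^ 2 + ν * (P.Cp / P.δ u t ^ 2 * W u t) := hDle _ hLap
  have h2 : ν * (P.Cp / P.δ u t ^ 2 * W u t) ≤ max P.Cp 1 * ν / P.δ u t ^ 2 * W u t := by
    have hCp : P.Cp ≤ max P.Cp 1 := le_max_left _ _
    have hνW : 0 ≤ ν * W u t / P.δ u t ^ 2 := div_nonneg (mul_nonneg hν.le hW) hδ2.le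
    calc ν * (P.Cp / P.δ u t ^ 2 * W u t) = P.Cp * (ν * W u t / P.δ u t ^ 2) := by ring
      _ ≤ max P.Cp 1 * (ν * W u t / P.δ u t ^ 2) := mul_le_mul_of_nonneg_right hCp hνW
      _ = max P.Cp 1 * ν / P.δ u t ^ 2 * W u t := by ring
  linarith

/-- **COMPOSITION on the open binders only** (rev 5): as `claim_of_open_steps` with `Step56_subst P`
discharged — the printed chain now stands or falls with the refuted head `Step4_CZ`, the maximum-principle
line `Step5_maxPrinciple`, the posits `PositLap P` / `PositDecay P`, the «dropping» inference
`Step67_dropping P`, the datum step `Step43 P` and the conclusion-level `Step52`. PROVED, pure logic;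
nothing asserted. [cite: Piromthan2025, §3–§5 pp.3–7] -/
theorem claim_of_open_steps₅ (P : Posits) (h4 : Step4_CZ) (h5m : Step5_maxPrinciple) (hL : PositLap P)
    (hD : PositDecay P) (h67 : Step67_dropping P) (h43 : Step43 P) (h52 : Step52) : ClaimedTheorem :=
  claim_of_open_steps P h4 h5m hL (step56_subst_holds P) hD h67 h43 h52

/-- `clay_of_steps` on the rev-5 open binders. [cite: FeffermanClay2006, (C) p. 2] -/
theorem clay_of_open_steps₅ (P : Posits) (h4 : Step4_CZ) (h5m : Step5_maxPrinciple) (hL : PositLap P)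
    (hD : PositDecay P) (h67 : Step67_dropping P) (h43 : Step43 P) (h52 : Step52) :
    ClayVariants.clayR3.Breakdown :=
  clay_of_claimed (claim_of_open_steps₅ P h4 h5m hL hD h67 h43 h52)

end Literature.Claims.NS.Piromthan2025

-- WHAT THIS IS NOT: not a claim about NS regularity or blow-up; not a claim about any author beyond the
-- typed locator.
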